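import Mathlib
import Literature.NumberTheory.LFunctions.KloostermanWeil
import HarnessLib

/-!
# Kloosterman sums: twisted multiplicativity and the reduction of Weil's bound to prime powers — PROVED

Topic `NumberTheory/LFunctions` (exponential sums); sequel of `KloostermanPrimePower.lean`
(`Literature.NumberTheory.LFunctions.kloostermanSum q a b = ∑_{x ∈ (ℤ/qℤ)ˣ} e((a x + b x̄)/q)`)
and `KloostermanWeil.lean` (the named fact `weil_kloosterman_bound`:
`|S(m, n; c)| ≤ (m, n, c)^{1/2} c^{1/2} τ(c)` for every modulus `c ≥ 1`,
[cite: Iwaniec2002, §2.5 (2.25)]).  This file PROVES the classical first step of every proof of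
(2.25): the bound is multiplicative in the modulus, so it suffices to know it for prime powers.

* `stdAddChar_eq_mul_of_coprime` — for `(c₁, c₂) = 1`, `e(y/c₁c₂) = e(c̄₂ y/c₁) e(c̄₁ y/c₂)`
  (`c₂ c̄₂ ≡ 1 (mod c₁)`, `c₁ c̄₁ ≡ 1 (mod c₂)`);
* `kloostermanSum_mul_of_coprime` — **twisted multiplicativity**
  `S(a, b; c₁c₂) = S(c̄₂ a, c̄₂ b; c₁) · S(c̄₁ a, c̄₁ b; c₂)` (Iwaniec–Kowalski (1.59));
* `weil_kloosterman_bound_of_primePow` — **(2.25) for all prime-power moduli implies (2.25)**,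
  by induction over the coprime factorisation (`Nat.recOnPrimeCoprime`), using
  `τ(c₁c₂) = τ(c₁)τ(c₂)`, `(g, c₁c₂) = (g, c₁)(g, c₂)` and `(c̄₂ m, c̄₂ n, c₁) = (m, n, c₁)`.

Everything here is proved; no new named fact is introduced.

## References

* H. Iwaniec, *Spectral Methods of Automorphic Forms*, 2nd ed., GSM 53 (2002), §2.5 (`Iwaniec2002`).
* H. Iwaniec, E. Kowalski, *Analytic Number Theory*, AMS Colloq. Publ. 53 (2004), (1.59), §11.
-/

noncomputable section

open Finset

namespace Literature.NumberTheory.LFunctions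

/-! ### The additive character of a product of coprime moduli -/

/-- For coprime `c₁, c₂` and `N = c̄₂ c₂ + c̄₁ c₁` (`c̄₂ = (c₂ mod c₁)⁻¹`, `c̄₁ = (c₁ mod c₂)⁻¹` read as
natural numbers) one has `N ≡ 1 (mod c₁c₂)`. [folklore] -/
theorem crt_unit_combination {c₁ c₂ : ℕ} [NeZero c₁] [NeZero c₂] (h : c₁.Coprime c₂) :
    ((((c₂ : ZMod c₁)⁻¹).val * c₂ + ((c₁ : ZMod c₂)⁻¹).val * c₁ : ℕ) : ZMod (c₁ * c₂)) = 1 := by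
  have h1 : (((c₂ : ZMod c₁)⁻¹).val * c₂ + ((c₁ : ZMod c₂)⁻¹).val * c₁ : ℕ) ≡ 1 [MOD c₁] := by
    rw [← ZMod.natCast_eq_natCast_iff]
    push_cast
    rw [ZMod.natCast_self, mul_zero, add_zero, ZMod.natCast_zmod_val, mul_comm,
      ZMod.coe_mul_inv_eq_one _ h.symm]
  have h2 : (((c₂ : ZMod c₁)⁻¹).val * c₂ + ((c₁ : ZMod c₂)⁻¹).val * c₁ : ℕ) ≡ 1 [MOD c₂] := by
    rw [← ZMod.natCast_eq_natCast_iff]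
    push_cast
    rw [ZMod.natCast_self, mul_zero, zero_add, ZMod.natCast_zmod_val, mul_comm,
      ZMod.coe_mul_inv_eq_one _ h]
  have h12 := (Nat.modEq_and_modEq_iff_modEq_mul h).mp ⟨h1, h2⟩
  have := (ZMod.natCast_eq_natCast_iff _ _ _).mpr h12
  rw [this, Nat.cast_one]

/-- **The standard character modulo `c₁c₂` splits**: for `(c₁, c₂) = 1` and `y ∈ ℤ/c₁c₂ℤ`,
`e(y/(c₁c₂)) = e(c̄₂ y / c₁) · e(c̄₁ y / c₂)`. [folklore] -/
theorem stdAddChar_eq_mul_of_coprime {c₁ c₂ : ℕ} [NeZero c₁] [NeZero c₂] [NeZero (c₁ * c₂)]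
    (h : c₁.Coprime c₂) (y : ZMod (c₁ * c₂)) :
    (ZMod.stdAddChar y : ℂ) =
      (ZMod.stdAddChar ((c₂ : ZMod c₁)⁻¹ * ZMod.castHom (dvd_mul_right c₁ c₂) (ZMod c₁) y) : ℂ) *
        (ZMod.stdAddChar ((c₁ : ZMod c₂)⁻¹ * ZMod.castHom (dvd_mul_left c₂ c₁) (ZMod c₂) y) : ℂ) := by
  have hy : y = ((y.val : ℕ) : ZMod (c₁ * c₂)) := (ZMod.natCast_zmod_val y).symm
  have hy1 : (c₂ : ZMod c₁)⁻¹ * ZMod.castHom (dvd_mul_right c₁ c₂) (ZMod c₁) y =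
      ((((c₂ : ZMod c₁)⁻¹).val * y.val : ℕ) : ZMod c₁) := by
    conv_lhs => rw [hy]
    rw [map_natCast]
    push_cast
    rw [ZMod.natCast_zmod_val]
  have hy2 : (c₁ : ZMod c₂)⁻¹ * ZMod.castHom (dvd_mul_left c₂ c₁) (ZMod c₂) y =
      ((((c₁ : ZMod c₂)⁻¹).val * y.val : ℕ) : ZMod c₂) := by
    conv_lhs => rw [hy]
    rw [map_natCast]
    push_cast
    rw [ZMod.natCast_zmod_val]
  have hlhs : (ZMod.stdAddChar y : ℂ) = ZMod.stdAddChar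
      (((((c₂ : ZMod c₁)⁻¹).val * c₂ + ((c₁ : ZMod c₂)⁻¹).val * c₁) * y.val : ℕ) :
        ZMod (c₁ * c₂)) := by
    rw [Nat.cast_mul, crt_unit_combination h, one_mul, ← hy]
  rw [hlhs, hy1, hy2, stdAddChar_natCast, stdAddChar_natCast, stdAddChar_natCast,
    ← Complex.exp_add]
  congr 1
  have h1 : (c₁ : ℂ) ≠ 0 := Nat.cast_ne_zero.mpr (NeZero.ne c₁)
  have h2 : (c₂ : ℂ) ≠ 0 := Nat.cast_ne_zero.mpr (NeZero.ne c₂)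
  push_cast
  field_simp

/-! ### Twisted multiplicativity -/

/-- For a unit `x` of `ℤ/qℤ`, the total inverse is carried to the inverse by `castHom`.
[folklore] -/
theorem castHom_inv_of_isUnit {q q' : ℕ} (h : q' ∣ q) {x : ZMod q} (hx : IsUnit x) :
    ZMod.castHom h (ZMod q') (x⁻¹) = (ZMod.castHom h (ZMod q') x)⁻¹ := by
  rw [ZMod.castHom_apply, ZMod.castHom_apply]
  exact ZMod.cast_inv_of_isUnit h hx

/-- Units of `ℤ/c₁c₂ℤ` for coprime `c₁, c₂`: `x` is a unit iff both reductions are. [folklore] -/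
theorem isUnit_iff_of_coprime {c₁ c₂ : ℕ} (h : c₁.Coprime c₂) (x : ZMod (c₁ * c₂)) :
    IsUnit x ↔ IsUnit (ZMod.castHom (dvd_mul_right c₁ c₂) (ZMod c₁) x) ∧
      IsUnit (ZMod.castHom (dvd_mul_left c₂ c₁) (ZMod c₂) x) := by
  have key : ZMod.chineseRemainder h x =
      (ZMod.castHom (dvd_mul_right c₁ c₂) (ZMod c₁) x,
        ZMod.castHom (dvd_mul_left c₂ c₁) (ZMod c₂) x) := by
    ext
    · exact Prod.fst_zmod_cast x
    · exact Prod.snd_zmod_cast x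
  have e : IsUnit x ↔ IsUnit (ZMod.chineseRemainder h x) :=
    ⟨fun hx => hx.map _, fun hx => by
      have := hx.map (ZMod.chineseRemainder h).symm
      rwa [RingEquiv.symm_apply_apply] at this⟩
  rw [e, key]
  exact Prod.isUnit_iff

/-- **Twisted multiplicativity of Kloosterman sums** (Iwaniec–Kowalski (1.59)): for coprime
moduli, `S(a, b; c₁c₂) = S(c̄₂ a, c̄₂ b; c₁) · S(c̄₁ a, c̄₁ b; c₂)` where `c̄₂ c₂ ≡ 1 (mod c₁)`,
`c̄₁ c₁ ≡ 1 (mod c₂)` and `a, b` are reduced modulo `c₁`, `c₂` on the right. [folklore] -/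
theorem kloostermanSum_mul_of_coprime {c₁ c₂ : ℕ} [NeZero c₁] [NeZero c₂] [NeZero (c₁ * c₂)]
    (h : c₁.Coprime c₂) (a b : ZMod (c₁ * c₂)) :
    kloostermanSum (c₁ * c₂) a b =
      kloostermanSum c₁ ((c₂ : ZMod c₁)⁻¹ * ZMod.castHom (dvd_mul_right c₁ c₂) (ZMod c₁) a)
          ((c₂ : ZMod c₁)⁻¹ * ZMod.castHom (dvd_mul_right c₁ c₂) (ZMod c₁) b) *
        kloostermanSum c₂ ((c₁ : ZMod c₂)⁻¹ * ZMod.castHom (dvd_mul_left c₂ c₁) (ZMod c₂) a)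
          ((c₁ : ZMod c₂)⁻¹ * ZMod.castHom (dvd_mul_left c₂ c₁) (ZMod c₂) b) := by
  classical
  set π₁ := ZMod.castHom (dvd_mul_right c₁ c₂) (ZMod c₁) with hπ₁
  set π₂ := ZMod.castHom (dvd_mul_left c₂ c₁) (ZMod c₂) with hπ₂
  set e₂ : ZMod c₁ := (c₂ : ZMod c₁)⁻¹ with he₂
  set e₁ : ZMod c₂ := (c₁ : ZMod c₂)⁻¹ with he₁
  set E := ZMod.chineseRemainder h with hE
  have hE1 : ∀ x, (E x).1 = π₁ x := fun x => Prod.fst_zmod_cast x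
  have hE2 : ∀ x, (E x).2 = π₂ x := fun x => Prod.snd_zmod_cast x
  -- the summand in product form
  set g₁ : ZMod c₁ → ℂ := fun x₁ =>
    if IsUnit x₁ then (ZMod.stdAddChar (e₂ * π₁ a * x₁ + e₂ * π₁ b * x₁⁻¹) : ℂ) else 0 with hg₁
  set g₂ : ZMod c₂ → ℂ := fun x₂ =>
    if IsUnit x₂ then (ZMod.stdAddChar (e₁ * π₂ a * x₂ + e₁ * π₂ b * x₂⁻¹) : ℂ) else 0 with hg₂
  have hS : kloostermanSum (c₁ * c₂) a b = ∑ x : ZMod (c₁ * c₂), g₁ (E x).1 * g₂ (E x).2 := by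
    unfold kloostermanSum
    refine Finset.sum_congr rfl fun x _ => ?_
    rw [hE1, hE2]
    by_cases hx : IsUnit x
    · obtain ⟨hx1, hx2⟩ := (isUnit_iff_of_coprime h x).mp hx
      rw [if_pos hx]
      simp only [hg₁, hg₂]
      rw [if_pos hx1, if_pos hx2, stdAddChar_eq_mul_of_coprime h]
      congr 2
      · rw [map_add, map_mul, map_mul, castHom_inv_of_isUnit _ hx]; ring
      · rw [map_add, map_mul, map_mul, castHom_inv_of_isUnit _ hx]; ring
    · have hx' : ¬ (IsUnit (π₁ x) ∧ IsUnit (π₂ x)) := fun h' =>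
        hx ((isUnit_iff_of_coprime h x).mpr h')
      rw [if_neg hx]
      simp only [hg₁, hg₂]
      by_cases h1 : IsUnit (π₁ x)
      · rw [if_neg (fun h2 => hx' ⟨h1, h2⟩), mul_zero]
      · rw [if_neg h1, zero_mul]
  rw [hS, Fintype.sum_equiv E.toEquiv (fun x => g₁ (E x).1 * g₂ (E x).2)
    (fun y : ZMod c₁ × ZMod c₂ => g₁ y.1 * g₂ y.2) (fun x => rfl), Fintype.sum_prod_type,
    ← Fintype.sum_mul_sum]
  -- both sides now agree definitionally (`kloostermanSum` unfolds to the sums of `g₁`, `g₂`)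
  rfl

/-! ### From prime powers to all moduli -/

/-- The gcd in (2.25) is insensitive to multiplying `m, n` by a number `e` coprime to `c`.
[folklore] -/
theorem gcd_gcd_mul_natAbs {e c : ℕ} (he : e.Coprime c) (m n : ℤ) :
    Nat.gcd (Nat.gcd ((e : ℤ) * m).natAbs ((e : ℤ) * n).natAbs) c =
      Nat.gcd (Nat.gcd m.natAbs n.natAbs) c := by
  rw [Int.natAbs_mul, Int.natAbs_mul, Int.natAbs_natCast, Nat.gcd_mul_left,
    Nat.Coprime.gcd_mul_left_cancel _ he]

/-- The right-hand side of (2.25) is multiplicative over coprime moduli. [folklore] -/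
theorem weil_rhs_mul {c₁ c₂ : ℕ} (h : c₁.Coprime c₂) (g : ℕ) :
    Real.sqrt (Nat.gcd g (c₁ * c₂)) * Real.sqrt ((c₁ * c₂ : ℕ)) * ((c₁ * c₂).divisors.card : ℝ) =
      (Real.sqrt (Nat.gcd g c₁) * Real.sqrt c₁ * (c₁.divisors.card : ℝ)) *
        (Real.sqrt (Nat.gcd g c₂) * Real.sqrt c₂ * (c₂.divisors.card : ℝ)) := by
  rw [Nat.Coprime.gcd_mul _ h, Nat.Coprime.card_divisors_mul h]
  push_cast
  rw [Real.sqrt_mul (Nat.cast_nonneg _), Real.sqrt_mul (Nat.cast_nonneg _)]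
  ring

/-- The twisting unit `c̄₂ = (c₂ mod c₁)⁻¹`, read as a natural number, is coprime to `c₁`.
[folklore] -/
theorem val_inv_natCast_coprime {c₁ c₂ : ℕ} [NeZero c₁] (h : c₁.Coprime c₂) :
    ((c₂ : ZMod c₁)⁻¹).val.Coprime c₁ := by
  obtain ⟨u, hu⟩ := (ZMod.isUnit_iff_coprime c₂ c₁).mpr h.symm
  rw [← hu, ZMod.inv_coe_unit]
  exact ZMod.val_coe_unit_coprime _

/-- **Weil's bound (2.25) for all moduli from prime-power moduli — PROVED.**  If
`|S(m, n; p^k)| ≤ (m, n, p^k)^{1/2} p^{k/2} τ(p^k)` for every prime power `p^k` (`k ≥ 0`) and all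
integers `m, n`, then `weil_kloosterman_bound` holds (twisted multiplicativity and the
multiplicativity of `c ↦ (m, n, c)^{1/2} c^{1/2} τ(c)`). [cite: Iwaniec2002, §2.5 (2.25)] -/
theorem weil_kloosterman_bound_of_primePow
    (H : ∀ (c : ℕ) [NeZero c], (∃ p k : ℕ, p.Prime ∧ c = p ^ k) → ∀ m n : ℤ,
      ‖kloostermanSum c (m : ZMod c) (n : ZMod c)‖ ≤
        Real.sqrt (Nat.gcd (Nat.gcd m.natAbs n.natAbs) c) * Real.sqrt c * (Nat.divisors c).card) :
    weil_kloosterman_bound := by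
  suffices key : ∀ c : ℕ, ∀ hc : c ≠ 0, ∀ m n : ℤ,
      ‖@kloostermanSum c ⟨hc⟩ (m : ZMod c) (n : ZMod c)‖ ≤
        Real.sqrt (Nat.gcd (Nat.gcd m.natAbs n.natAbs) c) * Real.sqrt c * (Nat.divisors c).card by
    intro c _ m n
    exact key c (NeZero.ne c) m n
  intro c
  induction c using Nat.recOnPrimeCoprime with
  | zero => intro hc; exact absurd rfl hc
  | prime_pow p k hp =>
      intro hc m n
      haveI : NeZero (p ^ k) := ⟨hc⟩
      exact H (p ^ k) ⟨p, k, hp, rfl⟩ m n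
  | coprime c₁ c₂ hc₁ hc₂ hcop ih₁ ih₂ =>
      intro hc m n
      haveI : NeZero c₁ := ⟨by omega⟩
      haveI : NeZero c₂ := ⟨by omega⟩
      haveI : NeZero (c₁ * c₂) := ⟨hc⟩
      have hcop₂ : ((c₂ : ZMod c₁)⁻¹).val.Coprime c₁ := val_inv_natCast_coprime hcop
      have hcop₁ : ((c₁ : ZMod c₂)⁻¹).val.Coprime c₂ := val_inv_natCast_coprime hcop.symm
      -- the factorisation, with integer parameters on the right
      have hfac := kloostermanSum_mul_of_coprime hcop (m : ZMod (c₁ * c₂)) (n : ZMod (c₁ * c₂))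
      have hcast₁ : ∀ k : ℤ, (c₂ : ZMod c₁)⁻¹ *
          ZMod.castHom (dvd_mul_right c₁ c₂) (ZMod c₁) (k : ZMod (c₁ * c₂)) =
            (((((c₂ : ZMod c₁)⁻¹).val : ℤ) * k : ℤ) : ZMod c₁) := by
        intro k; rw [map_intCast]; push_cast; rw [ZMod.natCast_zmod_val]
      have hcast₂ : ∀ k : ℤ, (c₁ : ZMod c₂)⁻¹ *
          ZMod.castHom (dvd_mul_left c₂ c₁) (ZMod c₂) (k : ZMod (c₁ * c₂)) =
            (((((c₁ : ZMod c₂)⁻¹).val : ℤ) * k : ℤ) : ZMod c₂) := by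
        intro k; rw [map_intCast]; push_cast; rw [ZMod.natCast_zmod_val]
      rw [hcast₁, hcast₁, hcast₂, hcast₂] at hfac
      have hb₁ := ih₁ (NeZero.ne c₁) ((((c₂ : ZMod c₁)⁻¹).val : ℤ) * m)
        ((((c₂ : ZMod c₁)⁻¹).val : ℤ) * n)
      have hb₂ := ih₂ (NeZero.ne c₂) ((((c₁ : ZMod c₂)⁻¹).val : ℤ) * m)
        ((((c₁ : ZMod c₂)⁻¹).val : ℤ) * n)
      rw [gcd_gcd_mul_natAbs hcop₂] at hb₁
      rw [gcd_gcd_mul_natAbs hcop₁] at hb₂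
      rw [hfac, norm_mul, weil_rhs_mul hcop]
      exact mul_le_mul hb₁ hb₂ (norm_nonneg _) (by positivity)

end Literature.NumberTheory.LFunctions

end
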